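import Literature.MathematicalPhysics.QuantumFieldTheory.Balaban1983to89.T4TermFormat

/-!
# T4GatedBooking — the gated induction driver of the hierarchical booking (cell `pub-balaban`, T4-DAG v3 §5,
self-proposed kernel sub-row T4-O3.E-iii-b-K* under row T4-O3.E-iii-b; bookkeeping)

HONEST FRAMING (cell `pub-balaban`, T4-DAG PAGE 1).  The cell's T4 target is the existence AND uniqueness of the
continuum limit of Bałaban's unit-scale averaged loop expectations on a finite torus — a constructive-QFT statement
strictly beyond ultraviolet stability ([Balaban1989LargeFieldII] Thm 1 p. 355); it is NOT the Yang–Mills mass gap and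
NOT the Clay problem.  This module is KERNEL BOOKKEEPING over the landed format `T4TermFormat.Booking` (row
T4-O3.E-iii-a): the LOGICAL SHAPE of the induction on scales that the cell's hierarchical booking H2 (referee record
`t4/T4-REF-O3.md` v1 V4/V5, a cell ANALYSIS, NOT in print) has to run, and the two pieces of elementary real analysis it
consumes.  It asserts NOTHING about Bałaban's renormalization-group objects: every predicate below is a HYPOTHESIS SHAPE
over the abstract arrays of a `Booking` (sizes `size b k`, pair strengths, currency draws) or over abstract real
sequences (couplings `gs j`, radii `R j`); the one-step preservation itself — the cell's open estimate NE1′, rows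
O3.E-i′ / O3.E-ii / O3.E-iii-b / O3.E-iii-c — enters ONLY as the hypothesis `GatedStep`, never as a fact.  The ONE tree
predicate about couplings consumed, `Step.Discrete031 b β' K g gs` (the endpoint running (0.31) of [Balaban1987RG1] in
the tree's per-step normalisation), is a HYPOTHESIS on an abstract sequence (cell flag COND-BetaPertH).  Every theorem
is [folklore] (finite sums, induction on `ℕ`, monotonicity of powers, a `p`-series).  Value = kernel bookkeeping of an
implication ⇐ named inputs; NOT summit progress, NOT the estimate NE1′, NOT row O3.E-iii-b's located record (which is
`t4/T4-EST-O3Eiiib.md`, another seat's).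

WHY A GATED INDUCTION (the point of this module).  `T4TermFormat.Booking.sizeBound_of_step` runs the induction on
scales with a step hypothesis PER BIRTH: "if the term born at `b` has size `≤ σ` at scale `k`, it has size `≤ σ` at
scale `k+1`".  The printed one-step mechanism is COLLECTIVE: the cluster expansion of [Balaban1988RG2Cluster] §2 treats
ALL terms of the exponent at scale `k` at once, and what it needs from them at scale `k` is a budget at every per-point
locus — p. 16, after (2.19): "The sum of these quadratic forms over Y∈D is bounded by a quadratic form with the above
matrix elements resummed over all Y∈D_k containing, for example, the point b₋. We use the first exponential factor in
(2.19) to bound the sum, and this yields a constant O(1). In fact the constant is small for κ₁ large, hence we can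
bound it by 1." [cite: Balaban1988RG2Cluster, (2.20) p. 16] — whose analogue for tube-attached terms without tree decay
is the cell's located per-cube budget (TOB-k) (`T4TermFormat.Booking.CubeBudget`, T4-REF-O3 V2 (c)), together with the
Mayer smallness of the pair class and the quadratic-currency slot (`MayerSmall`, `EtaBudget`).  So the honest step
hypothesis for a D-term born at `b` is GATED by scale-`k` predicates of ALL terms alive at `k`, and the induction looks
circular: the step at `k` needs (TOB-k), and (TOB-k) needs the sizes at `k`.  It is not: every gate at scale `k` is a
function of the sizes AT scale `k` only (`GateOfSizes`), so a strong induction on `k` closes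
(`sizeBoundAt_of_gatedStep`).  The printed induction it books alongside is the one closed on p. 21 of
[Balaban1988RG2Cluster]: "|E^{(k+1)}(X)| ≤ O(1)C₃ε₁ exp(−(1 − 10δ)½Lκd_{k+1}(X)). (2.41) Now we make our last
assumptions. At first we assume that (1 − 10δ)½L = 1, or δ = (1/10)(1 − 2L^{−1}). Next, we assume that
O(1)C₃ε₁ ≤ ½E₀." … "The inequality (2.41) and the assumptions imply the inequality (I.1.18), with ½E₀ instead of E₀,
for the terms of the effective action E^{(k+1)} in (I.1.3)." [cite: Balaban1988RG2Cluster, (2.41) p. 21], (I.1.18)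
being [Balaban1987RG1] p. 263: "There exists a constant E₀ such that |E^{(j)}(X, g_{j−1}, U, J)| ≤ E₀ exp(−κd_j(X))
(1.18) for M ≥ M(κ), γ sufficiently small, and for all configurations (U, J) ∈ U^c_j(X, α₀, α₁)."
[cite: Balaban1987RG1, (1.18) p. 263].  The weights of §4 are the printed control of the sum over birth scales,
[Balaban1988Convergent] p. 260: "|R^{(j)}(X, (U, J))| ≤ g_j^{κ₀} exp(−κd_j(X)) . (2.31) Here κ₀ can be chosen
arbitrarily large, similarly as κ, if the other parameters are fixed properly, as in [I]." … "The sum over X is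
controlled by the exponential factor, and by the factor (L^jη)⁴. The sum over j is controlled by g_j^{κ₀}."
[cite: Balaban1988Convergent, (2.31) p. 260].  (All four quotations read by this seat on the rendered journal pages;
they are CONTEXT — the manuscripts under audit are never used for a disputed step; the three B13/B12 loci are the
cell-certified L11/L15/L2 of `t4/T4-REF-O3.md` §1, XREAD C-pv21g3-10; the B14 locus is the certified header locus of
`T4TubeBudget`, XREAD C-ref6-46.)

What is proved (all [folklore]; `B : T4TermFormat.Booking` fixed, `K = B.K`, `j` = birth scale, `k` = current scale).
§1 PER-SCALE PREDICATES `SizeBoundAt σ k`, `CubeBudgetAt w c k`, `EtaBudgetAt η η₀ k`, `MayerSmallAt u ε k`, the birth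
   bound `BirthBound σ`, and the equivalences with the landed global predicates: `SizeBound σ ↔ ∀ k ≤ K, SizeBoundAt σ k`
   (`sizeBound_iff`), likewise `cubeBudget_iff`, `etaBudget_iff`, `mayerSmall_iff`.
§2 THE GATED INDUCTION.  `GatedStep σ Gate` := for `k < K`, `Gate k` and `SizeBoundAt σ k` give the sizes at `k+1` of
   the terms born `≤ k`; `GateOfSizes σ Gate` := for `k ≤ K`, `SizeBoundAt σ k` gives `Gate k`.  THEN
   `BirthBound σ`, `GateOfSizes σ Gate`, `GatedStep σ Gate` ⊢ `SizeBoundAt σ k` and `Gate k` for every `k ≤ K`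
   (`sizeBoundAt_of_gatedStep`, `gate_of_gatedStep`), hence `SizeBound σ` (`sizeBound_of_gatedStep`).  The per-birth step
   of `T4TermFormat` is the special case of a gate-independent step (`gatedStep_of_step`); gates compose by conjunction
   and implication (`GateOfSizes.and`, `GateOfSizes.imp`, `GatedStep.of_imp`).
§2b THE SAME AT FUNCTION LEVEL over `C : B.CarrierAt` (T4TermFormat v1.2 §4b): `NormBoundAt C σ k`, `BirthNormBound`,
   `GatedOneStepBound C σ Gate`, `GateOfNorms`; `normBound_iff`; the gated twin of `CarrierAt.normBound_of_step`:
   `BirthNormBound`, `GateOfNorms`, `GatedOneStepBound` ⊢ `NormBoundAt σ k` and `Gate k` for all `k ≤ K`, hence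
   `C.NormBound σ` (`normBoundAt_of_gatedStep`, `gate_of_gatedOneStepBound`, `normBound_of_gatedStep`); the ungated
   `CarrierAt.OneStepBound` is the gate-independent special case (`gatedOneStepBound_of_oneStepBound`); a gate met from
   sizes is met from norms once the sizes are chosen `≤ σ` where the norm bound holds (`gateOfNorms_of_gateOfSizes`).
§3 GATE DISCHARGERS (how `GateOfSizes` is met for the three gates of the format).  (a) BUDGET: positional counts `N`,
   `σ ≥ 0`, nonnegative weights and the scale-`k` member of `T4TubeBudget.TubeBudget K w (N·σ) c` give
   `SizeBoundAt σ k → CubeBudgetAt w c k` (`cubeBudgetAt_of_sizeBoundAt`; the per-scale cut of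
   `T4TermFormat.Booking.cubeBudget_of_tubeBudget`), so `TubeBudget` gives `GateOfSizes σ (CubeBudgetAt w c)`
   (`gateOfSizes_cubeBudgetAt`).  (b) CURRENCY: if every alive term's draw is at most `λ ·` its size at the current
   scale, the draw per `k`-cube is at most `λ · Σ_{j ≤ k} N j k σ j k` (`etaBudgetAt_of_sizeBoundAt`,
   `gateOfSizes_etaBudgetAt`); WITHOUT coupling weights that sum is K-uniform under a STRICT rate product,
   `N j k σ j k ≤ C ρ^{k−j}`, `0 ≤ ρ < 1` ⊢ `≤ C/(1−ρ)` (`sum_count_mul_size_le_geom`) — recorded because the budget gate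
   (a) tolerates the non-strict products `L⁴θ₁² ≤ 1`, `L⁴θ₁φ ≤ 1` only thanks to the weights.  (c) MAYER: pair
   strengths dominated by `v b b′ k · size b k · size b′ k` with `Σ_{b′} v b b′ k · u b′ ≤ V` and sizes `≤ τ` at scale `k`
   give `MayerSmallAt u (τ²V) k` (`mayerSmallAt_of_sizeBoundAt`, `gateOfSizes_mayerSmallAt`).  ASSEMBLED:
   `BirthBound σ` + counts + `TubeBudget K w (N·σ) c` + any further gate `H` met from sizes + a step gated by
   `CubeBudgetAt w c k ∧ H k` ⊢ `SizeBound σ ∧ CubeBudget w c ∧ ∀ k ≤ K, H k` (`sizeBound_cubeBudget_of_gatedStep`); the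
   two-rate instance (counts `≤ N₀Λ^{k−j}`, sizes `≤ Aφ^{k−j}τ^{K−j}`, `Λφτ ≤ 1`, total weight `≤ W`, budget `(N₀A)W`, via
   `T4TubeBudget.tubeBudget_of_rate`) is `sizeBound_cubeBudget_of_gatedStep_twoRate`.
§4 THE COUPLING WEIGHTS ALONG (0.31) (the input `Summable ω` of `T4TubeBudget.tubeBudget_uniform`, which the header of
   `T4TubeBudget` leaves to the consumer rows): under the LOWER half of `Step.Discrete031 b β' K g gs` with `b > 0`,
   `g > 0`, `gs j > 0`: `gs_j² ≤ (1/g² + b(K−j))⁻¹` (`sq_le_inv_of_discrete031`); with the polynomial radius profile of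
   `T4TubeBudget.radius_profile_of_discrete031` (`R j ≤ D(1/g²+β')^r((K−j)+1)^r`, from the UPPER half and `gs ≤ 1`), the
   weights `gs_j^{2p} R_j^c` are dominated by the K-INDEPENDENT profile `Cw/((K−j)+1)²`,
   `Cw = (min(1/g², b))^{−p}·(D(1/g²+β')^r)^c`, as soon as `p ≥ rc + 2` (`weight_le_profile_of_discrete031`); the profile
   is summable (`summable_weightProfile`), so `Σ_{j ≤ K} gs_j^{2p} R_j^c ≤ Σ' n, Cw/(n+1)²` for every `K`
   (`sum_weights_le_of_discrete031`), and for `K`-indexed families with the same `b, β', g` the SAME constant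
   `A · Σ' n, Cw/(n+1)²` is a tube budget at every final scale `K` for sizes of the rate shape `A Λ^{k−j} τ^{K−j}`, `Λτ ≤ 1`
   (`tubeBudget_uniform_of_discrete031`, via `T4TubeBudget.tubeBudget_uniform`).  `p ≥ rc + 2` (i.e. `κ₀ ≥ 4r + 2`
   for the cell's weights `g_j^{κ₀+2}R_j²`, V5 (iv)) is the CRUDE threshold forced by the linear bound `log x ≤ x`
   behind the polynomial profile — superseded by §4b, kept for its simpler constant.
§4b (v1.1) THE SHARP THRESHOLD `p ≥ 2`, FOR EVERY `r` AND `c` (i.e. `κ₀ ≥ 2`; answers the located gap G-pv18g4-1 of the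
   cell's GAPS.md): one power of the coupling absorbs the whole polylogarithm, `x·(log x⁻²)^m ≤ 2^m·m!` for
   `0 < x ≤ 1` (`mul_pow_log_inv_sq_le`, from `u^m/m! ≤ e^u` at `u = −log x`), and the remaining `gs_j^{2p−1}` is at
   most `(m/(n+1))^{p−1}·√(m/(n+1))`, `m = (min(1/g², b))⁻¹`, `n = K − j`; hence `gs_j^{2p} R_j^c ≤ sqrtProfile Cw' (K − j)`
   with the K-INDEPENDENT profile `Cw'/((n+1)√(n+1))` (= `Cw'·(n+1)^{−3/2}`, summable: `summable_sqrtProfile`, a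
   `p`-series with exponent `3/2`) and `Cw' = m^{p−1}·√m·(D^c·2^{rc}·(rc)!)` (`weight_le_sqrtProfile_of_discrete031`;
   only the LOWER half of (0.31) is used, `β'` not at all); `sum_weights_le_of_discrete031_sharp` and
   `tubeBudget_uniform_of_discrete031_sharp` are the `p ≥ 2` twins of the two §4 corollaries.  HONEST THRESHOLD NOW:
   `p ≥ 2` with natural `p` (weights `gs^{2p}`, `2p = κ₀ + 2`); `p = 1` (`κ₀ = 0`) genuinely fails along (0.31)
   (harmonic sum), and real exponents `κ₀ ∈ ]0, 2[` are not typed (they would need `Real.rpow` weights) — immaterial,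
   since the printed licence for a large `κ₀` is the p. 260 sentence quoted above.
§5 NON-VACUITY: the empty booking `vacuum K` (every predicate, any gate) and the one-birth booking `oneBirth K` with its
   constant carrier `oneBirthCarrier K`, where the budget gate is met from the sizes / norms and the gated inductions of
   §2 / §2b return `SizeBound 1 ∧ CubeBudget 1 1` / `NormBound 1` (`vacuum_gated`, `oneBirth_gated`,
   `oneBirthCarrier_gated`).

Deliberately NOT here: any statement that Bałaban's D-terms / exponent terms satisfy `GatedStep` (that is NE1′ and the
located estimate of row O3.E-iii-b, `t4/T4-EST-O3Eiiib.md`, another seat's; this module defines NO `PreservedUnderT`);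
which gates the printed S2–S6 loci actually impose (row O3.E-iii-b); the later ℝ-step (row O3.E-iii-c); the existence of
coupling sequences obeying (0.31) (tree `B12Beta`, `Beta.*`, COND-BetaPertH); the link radii ↔ (2.5) (row O4.K,
`T4UniformRadius`).  Imports: `T4TermFormat` only (through it `T4TubeBudget`, `Step`).

Versions: v1 p180311 (2026-08-18T22:30Z, commit 0f14d2f5bbfc; §1–§5).  v1.1 (this file): + §4b `sqrtProfile`,
`sqrtProfile_nonneg`, `summable_sqrtProfile`, `mul_pow_log_inv_sq_le`, `weight_le_sqrtProfile_of_discrete031`,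
`sum_weights_le_of_discrete031_sharp`, `tubeBudget_uniform_of_discrete031_sharp` (sharp threshold `p ≥ 2`) and the §4 /
§4b header paragraphs; ADDITIVE — no v1 declaration changed.
-/

namespace Literature.MathematicalPhysics.QuantumFieldTheory.Balaban1983to89.T4GatedBooking

open Finset
open Literature.MathematicalPhysics.QuantumFieldTheory.Balaban1983to89.T4TermFormat
open Literature.MathematicalPhysics.QuantumFieldTheory.Balaban1983to89.T4TermFormat.Booking

variable (B : T4TermFormat.Booking)

/-! ## §1 Per-scale predicates and their equivalence with the global ones -/

/-- HYPOTHESIS SHAPE — SIZE BOUND AT SCALE `k`: every term born at a scale `≤ k` has size `≤ σ (birth) k` at scale `k`.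
[folklore] -/
def SizeBoundAt (σ : ℕ → ℕ → ℝ) (k : ℕ) : Prop :=
  ∀ b : B.Birth, B.birthScale b ≤ k → B.size b k ≤ σ (B.birthScale b) k

/-- HYPOTHESIS SHAPE — THE BUDGET (TOB-k) AT SCALE `k` ONLY: every tube cube of scale `k` meets
`Σ_{j ≤ k} w j · load q j ≤ c` (cell analysis T4-REF-O3 V2 (c); printed per-point locus (2.20) p. 16).
[cite: Balaban1988RG2Cluster, (2.20) p. 16] -/
def CubeBudgetAt (w : ℕ → ℝ) (c : ℝ) (k : ℕ) : Prop :=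
  ∀ q : B.Cube, B.cubeScale q = k → ∑ j ∈ range (k + 1), w j * B.load q j ≤ c

/-- HYPOTHESIS SHAPE — THE QUADRATIC-CURRENCY SLOT AT SCALE `k` ONLY: the draws `η b k` of the terms felt at a cube of
scale `k` total at most `η₀`. [folklore] -/
def EtaBudgetAt (η : B.Birth → ℕ → ℝ) (η₀ : ℝ) (k : ℕ) : Prop :=
  ∀ q : B.Cube, B.cubeScale q = k → ∑ b ∈ B.feltAt q, η b k ≤ η₀

/-- HYPOTHESIS SHAPE — MAYER SMALLNESS OF THE PAIR CLASS AT SCALE `k` ONLY. [folklore] -/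
def MayerSmallAt (u : B.Birth → ℝ) (ε : ℝ) (k : ℕ) : Prop :=
  ∀ b ∈ B.alive k, ∑ b' ∈ B.alive k, |B.pair b b' k| * u b' ≤ ε

/-- HYPOTHESIS SHAPE — THE BIRTH BOUND: every term has size `≤ σ j j` at its birth scale `j` (row O3.E-i′ supplies it,
`T4TermFormat.Booking.birth_le_of_sizeShape`). [folklore] -/
def BirthBound (σ : ℕ → ℕ → ℝ) : Prop :=
  ∀ b : B.Birth, B.size b (B.birthScale b) ≤ σ (B.birthScale b) (B.birthScale b)

variable {B}

/-- `SizeBound σ` is `SizeBoundAt σ k` for every `k ≤ K`. [folklore] -/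
theorem sizeBound_iff {σ : ℕ → ℕ → ℝ} : B.SizeBound σ ↔ ∀ k, k ≤ B.K → SizeBoundAt B σ k :=
  ⟨fun h k hk b hbk => h b k hbk hk, fun h b k hbk hk => h k hk b hbk⟩

/-- `CubeBudget w c` is `CubeBudgetAt w c k` for every `k ≤ K`. [folklore] -/
theorem cubeBudget_iff {w : ℕ → ℝ} {c : ℝ} : B.CubeBudget w c ↔ ∀ k, k ≤ B.K → CubeBudgetAt B w c k := by
  constructor
  · intro h k _ q hq
    have hq' := h q
    rw [hq] at hq'
    exact hq'
  · intro h q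
    exact h (B.cubeScale q) (B.cube_le q) q rfl

/-- `EtaBudget η η₀` is `EtaBudgetAt η η₀ k` for every `k ≤ K`. [folklore] -/
theorem etaBudget_iff {η : B.Birth → ℕ → ℝ} {η₀ : ℝ} :
    B.EtaBudget η η₀ ↔ ∀ k, k ≤ B.K → EtaBudgetAt B η η₀ k := by
  constructor
  · intro h k _ q hq
    have hq' := h q
    rw [hq] at hq'
    exact hq'
  · intro h q
    exact h (B.cubeScale q) (B.cube_le q) q rfl

/-- `MayerSmall u ε` is `MayerSmallAt u ε k` for every `k ≤ K` (definitionally). [folklore] -/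
theorem mayerSmall_iff {u : B.Birth → ℝ} {ε : ℝ} : B.MayerSmall u ε ↔ ∀ k, k ≤ B.K → MayerSmallAt B u ε k :=
  Iff.rfl

/-- `SizeBoundAt` is monotone in the bounding array at that scale. [folklore] -/
theorem SizeBoundAt.mono {σ₁ σ₂ : ℕ → ℕ → ℝ} {k : ℕ} (h : SizeBoundAt B σ₁ k)
    (h12 : ∀ j, j ≤ k → σ₁ j k ≤ σ₂ j k) : SizeBoundAt B σ₂ k :=
  fun b hb => (h b hb).trans (h12 _ hb)

/-- `CubeBudgetAt` is monotone in the constant. [folklore] -/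
theorem CubeBudgetAt.mono {w : ℕ → ℝ} {c₁ c₂ : ℝ} {k : ℕ} (h : CubeBudgetAt B w c₁ k) (hc : c₁ ≤ c₂) :
    CubeBudgetAt B w c₂ k :=
  fun q hq => (h q hq).trans hc

/-! ## §2 The gated induction -/

variable (B)

/-- HYPOTHESIS SHAPE — THE GATED ONE-STEP PRESERVATION (the shape of NE1′'s induction step, rows O3.E-iii-b / -iii-c;
NOT asserted): for every `k < K`, the scale-`k` gate and the scale-`k` size bound of ALL alive terms give the size bound
at scale `k+1` of every term born at a scale `≤ k`. [folklore] -/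
def GatedStep (σ : ℕ → ℕ → ℝ) (Gate : ℕ → Prop) : Prop :=
  ∀ k, k < B.K → Gate k → SizeBoundAt B σ k →
    ∀ b : B.Birth, B.birthScale b ≤ k → B.size b (k + 1) ≤ σ (B.birthScale b) (k + 1)

/-- HYPOTHESIS SHAPE — THE GATE IS A FUNCTION OF THE CURRENT SIZES: for every `k ≤ K`, the scale-`k` size bound
gives the scale-`k` gate. [folklore] -/
def GateOfSizes (σ : ℕ → ℕ → ℝ) (Gate : ℕ → Prop) : Prop :=
  ∀ k, k ≤ B.K → SizeBoundAt B σ k → Gate k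

variable {B}

/-- Base: the birth bound is the size bound at scale `0`. [folklore] -/
theorem sizeBoundAt_zero {σ : ℕ → ℕ → ℝ} (h0 : BirthBound B σ) : SizeBoundAt B σ 0 := by
  intro b hb
  have hb0 : B.birthScale b = 0 := Nat.le_zero.mp hb
  have h := h0 b
  rw [hb0] at h ⊢
  exact h

/-- Step: gate and size bound at `k < K` give the size bound at `k+1` (terms born `≤ k` by the gated step, terms born at
`k+1` by the birth bound). [folklore] -/
theorem sizeBoundAt_succ {σ : ℕ → ℕ → ℝ} {Gate : ℕ → Prop} (h0 : BirthBound B σ) (hstep : GatedStep B σ Gate)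
    {k : ℕ} (hk : k < B.K) (hG : Gate k) (hP : SizeBoundAt B σ k) : SizeBoundAt B σ (k + 1) := by
  intro b hb
  rcases Nat.lt_or_eq_of_le hb with hlt | heq
  · exact hstep k hk hG hP b (Nat.lt_succ_iff.mp hlt)
  · have h := h0 b
    rw [heq] at h ⊢
    exact h

/-- **THE GATED INDUCTION CLOSES**: birth bound, gates met from the current sizes, and the gated step give the size
bound at every scale `k ≤ K`. [folklore] -/
theorem sizeBoundAt_of_gatedStep {σ : ℕ → ℕ → ℝ} {Gate : ℕ → Prop} (h0 : BirthBound B σ)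
    (hgate : GateOfSizes B σ Gate) (hstep : GatedStep B σ Gate) : ∀ k, k ≤ B.K → SizeBoundAt B σ k := by
  intro k
  induction k with
  | zero => exact fun _ => sizeBoundAt_zero h0
  | succ k ih =>
    intro hk
    have hk' : k < B.K := Nat.lt_of_succ_le hk
    have hP := ih hk'.le
    exact sizeBoundAt_succ h0 hstep hk' (hgate k hk'.le hP) hP

/-- … and every gate holds at every scale `k ≤ K`. [folklore] -/
theorem gate_of_gatedStep {σ : ℕ → ℕ → ℝ} {Gate : ℕ → Prop} (h0 : BirthBound B σ)
    (hgate : GateOfSizes B σ Gate) (hstep : GatedStep B σ Gate) : ∀ k, k ≤ B.K → Gate k :=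
  fun k hk => hgate k hk (sizeBoundAt_of_gatedStep h0 hgate hstep k hk)

/-- … hence the global `SizeBound σ` of `T4TermFormat`. [folklore] -/
theorem sizeBound_of_gatedStep {σ : ℕ → ℕ → ℝ} {Gate : ℕ → Prop} (h0 : BirthBound B σ)
    (hgate : GateOfSizes B σ Gate) (hstep : GatedStep B σ Gate) : B.SizeBound σ :=
  sizeBound_iff.mpr (sizeBoundAt_of_gatedStep h0 hgate hstep)

/-- The per-birth step of `T4TermFormat.Booking.sizeBound_of_step` is a gated step for EVERY gate (it ignores the gate
and uses only the term's own size). [folklore] -/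
theorem gatedStep_of_step {σ : ℕ → ℕ → ℝ}
    (hstep : ∀ (b : B.Birth) (k : ℕ), B.birthScale b ≤ k → k < B.K →
      B.size b k ≤ σ (B.birthScale b) k → B.size b (k + 1) ≤ σ (B.birthScale b) (k + 1))
    (Gate : ℕ → Prop) : GatedStep B σ Gate :=
  fun k hk _ hP b hb => hstep b k hb hk (hP b hb)

/-- The trivial gate is met from any sizes. [folklore] -/
theorem gateOfSizes_true {σ : ℕ → ℕ → ℝ} : GateOfSizes B σ (fun _ => True) :=
  fun _ _ _ => trivial

/-- Gates met from sizes compose by conjunction. [folklore] -/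
theorem GateOfSizes.and {σ : ℕ → ℕ → ℝ} {G₁ G₂ : ℕ → Prop} (h₁ : GateOfSizes B σ G₁) (h₂ : GateOfSizes B σ G₂) :
    GateOfSizes B σ (fun k => G₁ k ∧ G₂ k) :=
  fun k hk hP => ⟨h₁ k hk hP, h₂ k hk hP⟩

/-- A gate met from sizes implies every weaker gate. [folklore] -/
theorem GateOfSizes.imp {σ : ℕ → ℕ → ℝ} {G₁ G₂ : ℕ → Prop} (h : GateOfSizes B σ G₁)
    (h12 : ∀ k, k ≤ B.K → G₁ k → G₂ k) : GateOfSizes B σ G₂ :=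
  fun k hk hP => h12 k hk (h k hk hP)

/-- A step gated by `G₁` is gated by every stronger `G₂`. [folklore] -/
theorem GatedStep.of_imp {σ : ℕ → ℕ → ℝ} {G₁ G₂ : ℕ → Prop} (h : GatedStep B σ G₁)
    (h21 : ∀ k, k < B.K → G₂ k → G₁ k) : GatedStep B σ G₂ :=
  fun k hk hG hP => h k hk (h21 k hk hG) hP

/-! ## §2b The same induction at FUNCTION level, over the later-scale carrier `CarrierAt` (T4TermFormat v1.2 §4b)

`T4TermFormat.Booking.CarrierAt.normBound_of_step` runs the function-level induction along ONE branch with the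
per-birth `OneStepBound`.  Here the step may again be GATED by a scale-`k` predicate and may use the scale-`k` norm
bound of EVERY alive term; any gate that is a function of the current norm bounds closes the induction.  When a cell
record chooses `size b k` to be the supremum of `‖valAt b k‖` over domain × μ-ball, §2 and §2b coincide; the format
does not force that choice, so both are given. -/

/-- HYPOTHESIS SHAPE — FUNCTION-LEVEL NORM BOUND AT SCALE `k` of every term born `≤ k`, on domain × μ-ball.
[folklore] -/
def NormBoundAt (C : B.CarrierAt) (σ : ℕ → ℕ → ℝ) (k : ℕ) : Prop :=
  ∀ b : B.Birth, B.birthScale b ≤ k → ∀ (μ : ℂ) (ψ : C.FlucAt b k) (τ : C.Tower b), τ ∈ C.towerDom b →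
    ‖μ‖ < C.μ₀ → ‖C.valAt b k μ ψ τ‖ ≤ σ (B.birthScale b) k

/-- HYPOTHESIS SHAPE — THE BIRTH-LEVEL NORM BOUND `‖val b‖ ≤ σ j j` (the `h0` of `CarrierAt.normBound_of_step`).
[folklore] -/
def BirthNormBound (C : B.CarrierAt) (σ : ℕ → ℕ → ℝ) : Prop :=
  ∀ (b : B.Birth) (μ : ℂ) (ψ : C.Fluc b) (τ : C.Tower b), τ ∈ C.towerDom b → ‖μ‖ < C.μ₀ →
    ‖C.val b μ ψ τ‖ ≤ σ (B.birthScale b) (B.birthScale b)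

/-- HYPOTHESIS SHAPE — THE GATED ONE-STEP OPERATOR BOUND (function-level twin of `GatedStep`; NOT asserted): for
`k < K`, the gate at `k` and the norm bounds at `k` of ALL terms born `≤ k` give the norm bound at `k+1` of each of them.
[folklore] -/
def GatedOneStepBound (C : B.CarrierAt) (σ : ℕ → ℕ → ℝ) (Gate : ℕ → Prop) : Prop :=
  ∀ k, k < B.K → Gate k → NormBoundAt C σ k →
    ∀ b : B.Birth, B.birthScale b ≤ k → ∀ (μ : ℂ) (ψ : C.FlucAt b (k + 1)) (τ : C.Tower b), τ ∈ C.towerDom b →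
      ‖μ‖ < C.μ₀ → ‖C.valAt b (k + 1) μ ψ τ‖ ≤ σ (B.birthScale b) (k + 1)

/-- HYPOTHESIS SHAPE — THE GATE IS A FUNCTION OF THE CURRENT NORM BOUNDS. [folklore] -/
def GateOfNorms (C : B.CarrierAt) (σ : ℕ → ℕ → ℝ) (Gate : ℕ → Prop) : Prop :=
  ∀ k, k ≤ B.K → NormBoundAt C σ k → Gate k

/-- `CarrierAt.NormBound σ` is `NormBoundAt σ k` for every `k ≤ K`. [folklore] -/
theorem normBound_iff {C : B.CarrierAt} {σ : ℕ → ℕ → ℝ} : C.NormBound σ ↔ ∀ k, k ≤ B.K → NormBoundAt C σ k :=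
  ⟨fun h k hk b hbk μ ψ τ hτ hμ => h b k hbk hk μ ψ τ hτ hμ,
    fun h b k hbk hk μ ψ τ hτ hμ => h k hk b hbk μ ψ τ hτ hμ⟩

/-- At the birth scale the birth-level bound is the norm bound (transport along `flucAtBirth` / `valAt_birth`).
[folklore] -/
theorem norm_valAt_of_birth_eq {C : B.CarrierAt} {σ : ℕ → ℕ → ℝ} (h0 : BirthNormBound C σ) (b : B.Birth) {k : ℕ}
    (hk : B.birthScale b = k) (μ : ℂ) (ψ : C.FlucAt b k) (τ : C.Tower b) (hτ : τ ∈ C.towerDom b)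
    (hμ : ‖μ‖ < C.μ₀) : ‖C.valAt b k μ ψ τ‖ ≤ σ (B.birthScale b) k := by
  subst hk
  have e : ψ = C.flucAtBirth b ((C.flucAtBirth b).symm ψ) := by simp
  rw [e, C.valAt_birth]
  exact h0 b μ _ τ hτ hμ

/-- Base. [folklore] -/
theorem normBoundAt_zero {C : B.CarrierAt} {σ : ℕ → ℕ → ℝ} (h0 : BirthNormBound C σ) : NormBoundAt C σ 0 :=
  fun b hb μ ψ τ hτ hμ => norm_valAt_of_birth_eq h0 b (Nat.le_zero.mp hb) μ ψ τ hτ hμ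

/-- Step. [folklore] -/
theorem normBoundAt_succ {C : B.CarrierAt} {σ : ℕ → ℕ → ℝ} {Gate : ℕ → Prop} (h0 : BirthNormBound C σ)
    (hstep : GatedOneStepBound C σ Gate) {k : ℕ} (hk : k < B.K) (hG : Gate k) (hP : NormBoundAt C σ k) :
    NormBoundAt C σ (k + 1) := by
  intro b hb μ ψ τ hτ hμ
  rcases Nat.lt_or_eq_of_le hb with hlt | heq
  · exact hstep k hk hG hP b (Nat.lt_succ_iff.mp hlt) μ ψ τ hτ hμ
  · exact norm_valAt_of_birth_eq h0 b heq μ ψ τ hτ hμ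

/-- **THE GATED FUNCTION-LEVEL INDUCTION CLOSES**: birth-level bound, gates met from the current norm bounds and the
gated one-step operator bound give `NormBoundAt σ k` for every `k ≤ K`. [folklore] -/
theorem normBoundAt_of_gatedStep {C : B.CarrierAt} {σ : ℕ → ℕ → ℝ} {Gate : ℕ → Prop} (h0 : BirthNormBound C σ)
    (hgate : GateOfNorms C σ Gate) (hstep : GatedOneStepBound C σ Gate) : ∀ k, k ≤ B.K → NormBoundAt C σ k := by
  intro k
  induction k with
  | zero => exact fun _ => normBoundAt_zero h0
  | succ k ih =>
    intro hk
    have hk' : k < B.K := Nat.lt_of_succ_le hk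
    have hP := ih hk'.le
    exact normBoundAt_succ h0 hstep hk' (hgate k hk'.le hP) hP

/-- … every gate holds at every scale `k ≤ K` … [folklore] -/
theorem gate_of_gatedOneStepBound {C : B.CarrierAt} {σ : ℕ → ℕ → ℝ} {Gate : ℕ → Prop} (h0 : BirthNormBound C σ)
    (hgate : GateOfNorms C σ Gate) (hstep : GatedOneStepBound C σ Gate) : ∀ k, k ≤ B.K → Gate k :=
  fun k hk => hgate k hk (normBoundAt_of_gatedStep h0 hgate hstep k hk)

/-- … and `CarrierAt.NormBound σ` of `T4TermFormat` follows. [folklore] -/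
theorem normBound_of_gatedStep {C : B.CarrierAt} {σ : ℕ → ℕ → ℝ} {Gate : ℕ → Prop} (h0 : BirthNormBound C σ)
    (hgate : GateOfNorms C σ Gate) (hstep : GatedOneStepBound C σ Gate) : C.NormBound σ :=
  normBound_iff.mpr (normBoundAt_of_gatedStep h0 hgate hstep)

/-- The ungated `CarrierAt.OneStepBound` of `T4TermFormat` v1.2 is a gated one-step bound for EVERY gate. [folklore] -/
theorem gatedOneStepBound_of_oneStepBound {C : B.CarrierAt} {σ : ℕ → ℕ → ℝ} (hstep : C.OneStepBound σ)
    (Gate : ℕ → Prop) : GatedOneStepBound C σ Gate :=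
  fun k hk _ hP b hb μ ψ τ hτ hμ => hstep b k hb hk (fun μ' ψ' τ' hτ' hμ' => hP b hb μ' ψ' τ' hτ' hμ') μ ψ τ hτ hμ

/-- Gates met from norm bounds compose by conjunction. [folklore] -/
theorem GateOfNorms.and {C : B.CarrierAt} {σ : ℕ → ℕ → ℝ} {G₁ G₂ : ℕ → Prop} (h₁ : GateOfNorms C σ G₁)
    (h₂ : GateOfNorms C σ G₂) : GateOfNorms C σ (fun k => G₁ k ∧ G₂ k) :=
  fun k hk hP => ⟨h₁ k hk hP, h₂ k hk hP⟩

/-- **LINK §2b → §2**: if the size array dominates the bounding array's complement — precisely, if at every scale the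
norm bound `NormBoundAt σ k` is all one knows and the sizes were CHOSEN `≤ σ` wherever the norm bound holds
(`hchoice`) — then a gate met from sizes is met from norms.  (The typical choice `size b k := σ (birthScale b) k` once the
norm bound is established makes `hchoice` trivial; the format leaves the choice to the cell record.) [folklore] -/
theorem gateOfNorms_of_gateOfSizes {C : B.CarrierAt} {σ : ℕ → ℕ → ℝ} {Gate : ℕ → Prop}
    (hchoice : ∀ k, k ≤ B.K → NormBoundAt C σ k → SizeBoundAt B σ k) (h : GateOfSizes B σ Gate) :
    GateOfNorms C σ Gate :=
  fun k hk hP => h k hk (hchoice k hk hP)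

/-! ## §3 Gate dischargers -/

/-- THE LOAD BOUND AT SCALE `k`: `load q j ≤ N j k · σ j k` for a cube `q` of scale `k`, under `PositionalCount N` and
`SizeBoundAt σ k` (`σ · k ≥ 0`). [folklore] -/
theorem load_le_at {N σ : ℕ → ℕ → ℝ} {k : ℕ} (hN : B.PositionalCount N) (hP : SizeBoundAt B σ k)
    (hσ0 : ∀ j, 0 ≤ σ j k) (q : B.Cube) (hq : B.cubeScale q = k) (j : ℕ) :
    B.load q j ≤ N j k * σ j k := by
  subst hq
  show ∑ b ∈ B.feltOfScale q j, B.size b (B.cubeScale q) ≤ _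
  calc ∑ b ∈ B.feltOfScale q j, B.size b (B.cubeScale q)
      ≤ ∑ b ∈ B.feltOfScale q j, σ j (B.cubeScale q) := by
        refine sum_le_sum fun b hb => ?_
        obtain ⟨hb1, hb2⟩ := mem_feltOfScale.mp hb
        have h := hP b (B.felt_birth_le q b hb1)
        rwa [hb2] at h
    _ = ((B.feltOfScale q j).card : ℝ) * σ j (B.cubeScale q) := by rw [sum_const, nsmul_eq_mul]
    _ ≤ N j (B.cubeScale q) * σ j (B.cubeScale q) := mul_le_mul_of_nonneg_right (hN q j) (hσ0 j)

/-- **(a) THE BUDGET GATE FROM THE CURRENT SIZES** (per-scale cut of `T4TermFormat.Booking.cubeBudget_of_tubeBudget`):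
counts, `σ · k ≥ 0`, weights nonnegative up to `k`, and the scale-`k` inequality `Σ_{j ≤ k} w j · (N j k · σ j k) ≤ c`
give `SizeBoundAt σ k → CubeBudgetAt w c k`. [folklore] -/
theorem cubeBudgetAt_of_sizeBoundAt {N σ : ℕ → ℕ → ℝ} {w : ℕ → ℝ} {c : ℝ} {k : ℕ}
    (hw : ∀ j, j ≤ k → 0 ≤ w j) (hN : B.PositionalCount N) (hσ0 : ∀ j, 0 ≤ σ j k)
    (hT : ∑ j ∈ range (k + 1), w j * (N j k * σ j k) ≤ c) (hP : SizeBoundAt B σ k) :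
    CubeBudgetAt B w c k := by
  intro q hq
  calc ∑ j ∈ range (k + 1), w j * B.load q j ≤ ∑ j ∈ range (k + 1), w j * (N j k * σ j k) := by
        refine sum_le_sum fun j hj => ?_
        exact mul_le_mul_of_nonneg_left (load_le_at hN hP hσ0 q hq j)
          (hw j (Nat.lt_succ_iff.mp (mem_range.mp hj)))
    _ ≤ c := hT

/-- **(a′) … FROM THE TUBE BUDGET**: `T4TubeBudget.TubeBudget K w (N·σ) c` (row O3b.B, consumed BY NAME) is exactly the
family of scale-`k` inequalities, so it gives `GateOfSizes σ (CubeBudgetAt w c)`. [folklore] -/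
theorem gateOfSizes_cubeBudgetAt {N σ : ℕ → ℕ → ℝ} {w : ℕ → ℝ} {c : ℝ} (hw : ∀ j, j ≤ B.K → 0 ≤ w j)
    (hN : B.PositionalCount N) (hσ0 : ∀ j k, 0 ≤ σ j k)
    (hT : T4TubeBudget.TubeBudget B.K w (fun j k => N j k * σ j k) c) :
    GateOfSizes B σ (CubeBudgetAt B w c) :=
  fun k hk hP => cubeBudgetAt_of_sizeBoundAt (fun j hj => hw j (hj.trans hk)) hN (fun j => hσ0 j k)
    (by simpa using hT k hk) hP

/-- **(b) THE CURRENCY GATE FROM THE CURRENT SIZES**: if every alive term's draw at scale `k` is at most `λ ·` its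
size at scale `k` (`λ ≥ 0`), then under counts and `Σ_{j ≤ k} N j k · σ j k ≤ S` the draw per `k`-cube is at most
`λ · S`. [folklore] -/
theorem etaBudgetAt_of_sizeBoundAt {N σ : ℕ → ℕ → ℝ} {η : B.Birth → ℕ → ℝ} {lam S : ℝ} {k : ℕ}
    (hN : B.PositionalCount N) (hσ0 : ∀ j, 0 ≤ σ j k) (hlam : 0 ≤ lam)
    (hη : ∀ b : B.Birth, B.birthScale b ≤ k → η b k ≤ lam * B.size b k)
    (hS : ∑ j ∈ range (k + 1), N j k * σ j k ≤ S) (hP : SizeBoundAt B σ k) :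
    EtaBudgetAt B η (lam * S) k := by
  intro q hq
  subst hq
  have h1 : ∀ b ∈ B.feltAt q, η b (B.cubeScale q) ≤ lam * σ (B.birthScale b) (B.cubeScale q) :=
    fun b hb => (hη b (B.felt_birth_le q b hb)).trans
      (mul_le_mul_of_nonneg_left (hP b (B.felt_birth_le q b hb)) hlam)
  calc ∑ b ∈ B.feltAt q, η b (B.cubeScale q)
      ≤ ∑ j ∈ range (B.cubeScale q + 1), N j (B.cubeScale q) * (lam * σ j (B.cubeScale q)) :=
        sum_feltAt_le hN q (fun b => η b (B.cubeScale q)) (fun j => lam * σ j (B.cubeScale q)) h1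
          (fun j => mul_nonneg hlam (hσ0 j))
    _ = lam * ∑ j ∈ range (B.cubeScale q + 1), N j (B.cubeScale q) * σ j (B.cubeScale q) := by
        rw [mul_sum]
        exact sum_congr rfl fun j _ => by ring
    _ ≤ lam * S := mul_le_mul_of_nonneg_left hS hlam

/-- **(b′)** the same as a gate met from sizes, for draws dominated by sizes at every scale and a uniform bound `S` of
the unweighted count-times-size sums. [folklore] -/
theorem gateOfSizes_etaBudgetAt {N σ : ℕ → ℕ → ℝ} {η : B.Birth → ℕ → ℝ} {lam S : ℝ} (hN : B.PositionalCount N)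
    (hσ0 : ∀ j k, 0 ≤ σ j k) (hlam : 0 ≤ lam)
    (hη : ∀ (b : B.Birth) (k : ℕ), B.birthScale b ≤ k → k ≤ B.K → η b k ≤ lam * B.size b k)
    (hS : ∀ k, k ≤ B.K → ∑ j ∈ range (k + 1), N j k * σ j k ≤ S) :
    GateOfSizes B σ (EtaBudgetAt B η (lam * S)) :=
  fun k hk hP => etaBudgetAt_of_sizeBoundAt hN (fun j => hσ0 j k) hlam (fun b hb => hη b k hb hk) (hS k hk) hP

/-- **(b″) THE UNWEIGHTED SUM IS K-UNIFORM UNDER A STRICT RATE PRODUCT**: if `N j k · σ j k ≤ C · ρ^{k−j}` for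
`j ≤ k` with `C ≥ 0`, `0 ≤ ρ < 1`, then `Σ_{j ≤ k} N j k · σ j k ≤ C / (1 − ρ)` (a finite geometric sum; with
`ρ = Λφτ`-type products this is the currency gate's analogue of the weighted budget, and it needs the STRICT
inequality). [folklore] -/
theorem sum_count_mul_size_le_geom {N σ : ℕ → ℕ → ℝ} {C ρ : ℝ} {k : ℕ} (hC : 0 ≤ C) (hρ0 : 0 ≤ ρ) (hρ1 : ρ < 1)
    (h : ∀ j, j ≤ k → N j k * σ j k ≤ C * ρ ^ (k - j)) :
    ∑ j ∈ range (k + 1), N j k * σ j k ≤ C / (1 - ρ) := by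
  calc ∑ j ∈ range (k + 1), N j k * σ j k ≤ ∑ j ∈ range (k + 1), C * ρ ^ (k - j) :=
        sum_le_sum fun j hj => h j (Nat.lt_succ_iff.mp (mem_range.mp hj))
    _ = C * ∑ i ∈ range (k + 1), ρ ^ i := by
        have hrefl : ∑ j ∈ range (k + 1), C * ρ ^ (k + 1 - 1 - j) = ∑ j ∈ range (k + 1), C * ρ ^ j :=
          sum_range_reflect (fun i => C * ρ ^ i) (k + 1)
        rw [mul_sum, ← hrefl]
        simp only [Nat.add_sub_cancel]
    _ ≤ C * (1 / (1 - ρ)) := by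
        refine mul_le_mul_of_nonneg_left ?_ hC
        have hgeom := geom_sum_Ico_le_of_lt_one (m := 0) (n := k + 1) hρ0 hρ1
        rw [pow_zero, Nat.Ico_zero_eq_range] at hgeom
        exact hgeom
    _ = C / (1 - ρ) := by rw [mul_one_div]

/-- **(c) THE MAYER GATE FROM THE CURRENT SIZES**: pair strengths dominated by a nonnegative kernel times the two
current sizes, `|pair b b′ k| ≤ v b b′ k · size b k · size b′ k`, a kernel budget `Σ_{b′ alive} v b b′ k · u b′ ≤ V`
(`u, v ≥ 0`) and current sizes `≤ τ` (`τ ≥ 0`) give `MayerSmallAt u (τ² · V) k`. [folklore] -/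
theorem mayerSmallAt_of_sizeBoundAt {σ : ℕ → ℕ → ℝ} {u : B.Birth → ℝ} {v : B.Birth → B.Birth → ℕ → ℝ} {V τ : ℝ}
    {k : ℕ} (hu : ∀ b, 0 ≤ u b) (hv : ∀ b b', 0 ≤ v b b' k)
    (hpair : ∀ b b', |B.pair b b' k| ≤ v b b' k * B.size b k * B.size b' k)
    (hV : ∀ b ∈ B.alive k, ∑ b' ∈ B.alive k, v b b' k * u b' ≤ V) (hτ : 0 ≤ τ)
    (hστ : ∀ j, j ≤ k → σ j k ≤ τ) (hP : SizeBoundAt B σ k) : MayerSmallAt B u (τ ^ 2 * V) k := by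
  intro b hb
  have hsz : ∀ b₁ ∈ B.alive k, B.size b₁ k ≤ τ := fun b₁ hb₁ =>
    (hP b₁ (mem_alive.mp hb₁)).trans (hστ _ (mem_alive.mp hb₁))
  calc ∑ b' ∈ B.alive k, |B.pair b b' k| * u b'
      ≤ ∑ b' ∈ B.alive k, (τ ^ 2) * (v b b' k * u b') := by
        refine sum_le_sum fun b' hb' => ?_
        have h1 : |B.pair b b' k| ≤ v b b' k * τ * τ := by
          calc |B.pair b b' k| ≤ v b b' k * B.size b k * B.size b' k := hpair b b'
            _ ≤ v b b' k * τ * τ :=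
                mul_le_mul (mul_le_mul_of_nonneg_left (hsz b hb) (hv b b')) (hsz b' hb')
                  (B.size_nonneg b' k) (mul_nonneg (hv b b') hτ)
        calc |B.pair b b' k| * u b' ≤ (v b b' k * τ * τ) * u b' := mul_le_mul_of_nonneg_right h1 (hu b')
          _ = τ ^ 2 * (v b b' k * u b') := by ring
    _ = τ ^ 2 * ∑ b' ∈ B.alive k, v b b' k * u b' := by rw [mul_sum]
    _ ≤ τ ^ 2 * V := mul_le_mul_of_nonneg_left (hV b hb) (sq_nonneg τ)

/-- **(c′)** the same as a gate met from sizes (kernel data at every scale `k ≤ K`). [folklore] -/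
theorem gateOfSizes_mayerSmallAt {σ : ℕ → ℕ → ℝ} {u : B.Birth → ℝ} {v : B.Birth → B.Birth → ℕ → ℝ} {V τ : ℝ}
    (hu : ∀ b, 0 ≤ u b) (hv : ∀ b b' k, 0 ≤ v b b' k)
    (hpair : ∀ b b' k, k ≤ B.K → |B.pair b b' k| ≤ v b b' k * B.size b k * B.size b' k)
    (hV : ∀ k, k ≤ B.K → ∀ b ∈ B.alive k, ∑ b' ∈ B.alive k, v b b' k * u b' ≤ V) (hτ : 0 ≤ τ)
    (hστ : ∀ j k, j ≤ k → k ≤ B.K → σ j k ≤ τ) : GateOfSizes B σ (MayerSmallAt B u (τ ^ 2 * V)) :=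
  fun k hk hP => mayerSmallAt_of_sizeBoundAt hu (fun b b' => hv b b' k) (fun b b' => hpair b b' k hk) (hV k hk) hτ
    (fun j hj => hστ j k hj hk) hP

/-- **ASSEMBLED**: birth bound, positional counts, `σ ≥ 0`, nonnegative weights, the tube budget
`T4TubeBudget.TubeBudget K w (N·σ) c`, any further gate `H` met from the current sizes, and a one-step preservation
gated by `CubeBudgetAt w c k ∧ H k` give `SizeBound σ`, the budget `CubeBudget w c` at every cube, and `H` at every
scale.  This is the induction H2 has to run, with the budget as a GATE and not as an afterthought. [folklore] -/
theorem sizeBound_cubeBudget_of_gatedStep {N σ : ℕ → ℕ → ℝ} {w : ℕ → ℝ} {c : ℝ} {H : ℕ → Prop}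
    (h0 : BirthBound B σ) (hw : ∀ j, j ≤ B.K → 0 ≤ w j) (hN : B.PositionalCount N) (hσ0 : ∀ j k, 0 ≤ σ j k)
    (hT : T4TubeBudget.TubeBudget B.K w (fun j k => N j k * σ j k) c) (hH : GateOfSizes B σ H)
    (hstep : GatedStep B σ (fun k => CubeBudgetAt B w c k ∧ H k)) :
    B.SizeBound σ ∧ B.CubeBudget w c ∧ ∀ k, k ≤ B.K → H k := by
  have hgate : GateOfSizes B σ (fun k => CubeBudgetAt B w c k ∧ H k) :=
    (gateOfSizes_cubeBudgetAt hw hN hσ0 hT).and hH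
  exact ⟨sizeBound_of_gatedStep h0 hgate hstep,
    cubeBudget_iff.mpr fun k hk => (gate_of_gatedStep h0 hgate hstep k hk).1,
    fun k hk => (gate_of_gatedStep h0 hgate hstep k hk).2⟩

/-- **ASSEMBLED, TWO-RATE INSTANCE** (the gated form of `T4TermFormat.Booking.cubeBudget_of_twoRate`): counts
`N j k ≤ N₀Λ^{k−j}`, a bounding array with `0 ≤ σ j k ≤ Aφ^{k−j}τ^{K−j}` (`N₀, A, Λ, φ, τ ≥ 0`, `τ ≤ 1`, `Λφτ ≤ 1`),
nonnegative weights of total `≤ W`, the birth bound for `σ`, a further gate `H` met from sizes, and a step gated by the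
budget `(N₀A)W` and `H` give `SizeBound σ ∧ CubeBudget w ((N₀A)W) ∧ ∀ k ≤ K, H k`.  Whether the printed rates meet
`Λφτ ≤ 1` is NOT asserted. [folklore] -/
theorem sizeBound_cubeBudget_of_gatedStep_twoRate {N σ : ℕ → ℕ → ℝ} {w : ℕ → ℝ} {N₀ A Λ φ τ W : ℝ}
    {H : ℕ → Prop} (h0 : BirthBound B σ) (hw : ∀ j, j ≤ B.K → 0 ≤ w j) (hW : ∑ j ∈ range (B.K + 1), w j ≤ W)
    (hN : B.PositionalCount N) (hσ0 : ∀ j k, 0 ≤ σ j k) (hN₀ : 0 ≤ N₀) (hA : 0 ≤ A) (hΛ : 0 ≤ Λ) (hφ : 0 ≤ φ)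
    (hτ0 : 0 ≤ τ) (hτ1 : τ ≤ 1) (hΛφτ : Λ * φ * τ ≤ 1)
    (hNle : ∀ j k, j ≤ k → k ≤ B.K → N j k ≤ N₀ * Λ ^ (k - j))
    (hσle : ∀ j k, j ≤ k → k ≤ B.K → σ j k ≤ A * φ ^ (k - j) * τ ^ (B.K - j))
    (hH : GateOfSizes B σ H) (hstep : GatedStep B σ (fun k => CubeBudgetAt B w ((N₀ * A) * W) k ∧ H k)) :
    B.SizeBound σ ∧ B.CubeBudget w ((N₀ * A) * W) ∧ ∀ k, k ≤ B.K → H k := by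
  refine sizeBound_cubeBudget_of_gatedStep h0 hw hN hσ0 ?_ hH hstep
  refine T4TubeBudget.tubeBudget_of_rate hw hW (mul_nonneg hN₀ hA) (mul_nonneg hΛ hφ) hτ0 hτ1 hΛφτ ?_
  intro k hk j hjk
  calc N j k * σ j k ≤ (N₀ * Λ ^ (k - j)) * (A * φ ^ (k - j) * τ ^ (B.K - j)) :=
        mul_le_mul (hNle j k hjk hk) (hσle j k hjk hk) (hσ0 j k) (mul_nonneg hN₀ (pow_nonneg hΛ _))
    _ = N₀ * A * (Λ * φ) ^ (k - j) * τ ^ (B.K - j) := by rw [mul_pow]; ring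

/-! ## §4 The coupling weights along (0.31): a summable, K-independent profile of the remaining scales -/

/-- THE WEIGHT PROFILE `Cw / (n+1)²` of the number `n = K − j` of remaining scales. [folklore] -/
noncomputable def weightProfile (Cw : ℝ) (n : ℕ) : ℝ :=
  Cw / ((n : ℝ) + 1) ^ 2

/-- The profile is nonnegative for `Cw ≥ 0`. [folklore] -/
theorem weightProfile_nonneg {Cw : ℝ} (hC : 0 ≤ Cw) (n : ℕ) : 0 ≤ weightProfile Cw n :=
  div_nonneg hC (pow_nonneg (by positivity) _)

/-- The profile is summable (a `p`-series with `p = 2`). [folklore] -/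
theorem summable_weightProfile (Cw : ℝ) : Summable (weightProfile Cw) := by
  have h2 : Summable (fun n : ℕ => 1 / (n : ℝ) ^ 2) := Real.summable_one_div_nat_pow.mpr one_lt_two
  have h : Summable (fun n : ℕ => 1 / ((n : ℝ) + 1) ^ 2) := by
    have h' := (summable_nat_add_iff 1).mpr h2
    simpa [Nat.cast_add, Nat.cast_one] using h'
  have hfun : weightProfile Cw = fun n : ℕ => Cw * (1 / ((n : ℝ) + 1) ^ 2) := by
    funext n
    rw [weightProfile, mul_one_div]
  rw [hfun]
  exact h.mul_left Cw

/-- **THE PRINTED DECAY OF THE RUNNING COUPLING TOWARD THE ULTRAVIOLET, per step** (LOWER half of (0.31) of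
[Balaban1987RG1] in the tree's per-step normalisation `Step.Discrete031`: `1/g² + b(K − j) ≤ 1/gs_j²`): for `g > 0`,
`b ≥ 0`, `gs_j > 0`, `gs_j² ≤ (1/g² + b(K−j))⁻¹`.  Only the LOWER half of the hypothesis is used.
[cite: Balaban1987RG1, (0.31) p.259] -/
theorem sq_le_inv_of_discrete031 {b β' g : ℝ} {K : ℕ} {gs : ℕ → ℝ} (h : Step.Discrete031 b β' K g gs)
    (hg : 0 < g) (hb : 0 ≤ b) {j : ℕ} (hj : j ≤ K) (hgs : 0 < gs j) :
    gs j ^ 2 ≤ (1 / g ^ 2 + b * (((K - j : ℕ) : ℝ)))⁻¹ := by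
  have hlow := (h j hj).1
  have hcast : ((K : ℝ) - j) = (((K - j : ℕ) : ℝ)) := by rw [Nat.cast_sub hj]
  rw [hcast] at hlow
  have hD : 0 < 1 / g ^ 2 + b * (((K - j : ℕ) : ℝ)) := by positivity
  rw [one_div (gs j ^ 2)] at hlow
  exact (le_inv_comm₀ hD (pow_pos hgs 2)).mp hlow

/-- `min c b · (n+1) ≤ c + b·n`. [folklore] -/
theorem min_mul_succ_le (c b : ℝ) (n : ℕ) : min c b * ((n : ℝ) + 1) ≤ c + b * n := by
  have h1 : min c b ≤ c := min_le_left _ _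
  have h2 : min c b ≤ b := min_le_right _ _
  have hn : (0 : ℝ) ≤ n := Nat.cast_nonneg n
  nlinarith [mul_le_mul_of_nonneg_right h2 hn]

/-- **EVEN POWERS OF THE COUPLING DECAY LIKE A POWER OF THE REMAINING SCALES**: under the lower half of
`Step.Discrete031` with `b > 0`, `g > 0`, `gs_j > 0`: `gs_j^{2p} ≤ (min(1/g², b))^{−p} / ((K−j)+1)^p`. [folklore] -/
theorem pow_coupling_le_of_discrete031 {b β' g : ℝ} {K : ℕ} {gs : ℕ → ℝ} (h : Step.Discrete031 b β' K g gs)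
    (hg : 0 < g) (hb : 0 < b) (p : ℕ) {j : ℕ} (hj : j ≤ K) (hgs : 0 < gs j) :
    gs j ^ (2 * p) ≤ ((min (1 / g ^ 2) b)⁻¹) ^ p / ((((K - j : ℕ) : ℝ)) + 1) ^ p := by
  set n : ℕ := K - j with hn
  have hc : 0 < 1 / g ^ 2 := by positivity
  have hm : 0 < min (1 / g ^ 2) b := lt_min hc hb
  have hn1 : 0 < ((n : ℝ)) + 1 := by positivity
  have hmn : 0 < min (1 / g ^ 2) b * (((n : ℝ)) + 1) := mul_pos hm hn1
  have hD : min (1 / g ^ 2) b * (((n : ℝ)) + 1) ≤ 1 / g ^ 2 + b * (n : ℝ) := min_mul_succ_le _ _ n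
  have hsq : gs j ^ 2 ≤ (min (1 / g ^ 2) b * (((n : ℝ)) + 1))⁻¹ :=
    (sq_le_inv_of_discrete031 h hg hb.le hj hgs).trans (inv_anti₀ hmn hD)
  calc gs j ^ (2 * p) = (gs j ^ 2) ^ p := pow_mul _ 2 p
    _ ≤ ((min (1 / g ^ 2) b * (((n : ℝ)) + 1))⁻¹) ^ p := pow_le_pow_left₀ (sq_nonneg _) hsq p
    _ = ((min (1 / g ^ 2) b)⁻¹) ^ p / ((((n : ℝ)) + 1)) ^ p := by
        rw [mul_inv, mul_pow, inv_pow (((n : ℝ)) + 1),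
          div_eq_mul_inv (((min (1 / g ^ 2) b)⁻¹) ^ p) ((((n : ℝ)) + 1) ^ p)]

/-- `(n+1)^a / (n+1)^p ≤ 1 / (n+1)^2` for `a + 2 ≤ p`. [folklore] -/
theorem succ_pow_div_pow_le {a p : ℕ} (hp : a + 2 ≤ p) (n : ℕ) :
    (((n : ℝ)) + 1) ^ a / (((n : ℝ)) + 1) ^ p ≤ 1 / (((n : ℝ)) + 1) ^ 2 := by
  have hx : (1 : ℝ) ≤ (n : ℝ) + 1 := by
    have : (0 : ℝ) ≤ n := Nat.cast_nonneg n
    linarith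
  have hx0 : (0 : ℝ) < (n : ℝ) + 1 := by positivity
  rw [div_le_div_iff₀ (pow_pos hx0 p) (pow_pos hx0 2), one_mul, ← pow_add]
  exact pow_le_pow_right₀ hx hp

/-- **THE WEIGHTS ARE DOMINATED BY THE K-INDEPENDENT SUMMABLE PROFILE**: under `Step.Discrete031 b β' K g gs` (both
halves: the lower one for the couplings, the upper one for the radii), `b > 0`, `β' ≥ 0`, `g > 0`, couplings in
`]0, 1]`, radii `0 ≤ R j ≤ D(log gs_j⁻²)^r` (`D ≥ 0`; the polylogarithmic shape of (2.5) p. 255 of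
[Balaban1988Convergent], consumed through `T4TubeBudget.radius_profile_of_discrete031`) and the CRUDE THRESHOLD
`r·c + 2 ≤ p`: `gs_j^{2p} · R_j^c ≤ weightProfile Cw (K − j)` with
`Cw = (min(1/g², b))^{−p} · (D(1/g²+β')^r)^c` — a constant that does NOT depend on `K` or `j`. [folklore] -/
theorem weight_le_profile_of_discrete031 {b β' g D : ℝ} {K r p c : ℕ} {gs R : ℕ → ℝ}
    (h : Step.Discrete031 b β' K g gs) (hb : 0 < b) (hβ' : 0 ≤ β') (hg : 0 < g) (hD : 0 ≤ D)
    (hgs0 : ∀ j ≤ K, 0 < gs j) (hgs1 : ∀ j ≤ K, gs j ≤ 1) (hR0 : ∀ j ≤ K, 0 ≤ R j)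
    (hR : ∀ j ≤ K, R j ≤ D * (Real.log ((gs j) ^ 2)⁻¹) ^ r) (hp : r * c + 2 ≤ p) {j : ℕ} (hj : j ≤ K) :
    gs j ^ (2 * p) * R j ^ c
      ≤ weightProfile (((min (1 / g ^ 2) b)⁻¹) ^ p * (D * (1 / g ^ 2 + β') ^ r) ^ c) (K - j) := by
  set n : ℕ := K - j with hn
  set A : ℝ := D * (1 / g ^ 2 + β') ^ r with hA
  set m : ℝ := (min (1 / g ^ 2) b)⁻¹ with hm
  have hA0 : 0 ≤ A := mul_nonneg hD (pow_nonneg (by positivity) r)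
  have hm0 : 0 ≤ m := by
    have : 0 < min (1 / g ^ 2) b := lt_min (by positivity) hb
    exact inv_nonneg.mpr this.le
  have hx0 : (0 : ℝ) < (n : ℝ) + 1 := by positivity
  -- the radius profile, then its `c`-th power
  have hRj : R j ≤ A * (((n : ℝ)) + 1) ^ r := by
    have := T4TubeBudget.radius_profile_of_discrete031 h hβ' hD hgs0 hgs1 hR hj
    simpa [hA, hn] using this
  have hRc : R j ^ c ≤ A ^ c * (((n : ℝ)) + 1) ^ (r * c) := by
    calc R j ^ c ≤ (A * (((n : ℝ)) + 1) ^ r) ^ c := pow_le_pow_left₀ (hR0 j hj) hRj c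
      _ = A ^ c * (((n : ℝ)) + 1) ^ (r * c) := by rw [mul_pow, ← pow_mul]
  -- the coupling power
  have hgp : gs j ^ (2 * p) ≤ m ^ p / (((n : ℝ)) + 1) ^ p := by
    have := pow_coupling_le_of_discrete031 h hg hb p hj (hgs0 j hj)
    simpa [hm, hn] using this
  -- assemble
  have hprod : gs j ^ (2 * p) * R j ^ c ≤ (m ^ p / (((n : ℝ)) + 1) ^ p) * (A ^ c * (((n : ℝ)) + 1) ^ (r * c)) :=
    mul_le_mul hgp hRc (pow_nonneg (hR0 j hj) c) (div_nonneg (pow_nonneg hm0 p) (pow_nonneg hx0.le p))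
  have hratio : (((n : ℝ)) + 1) ^ (r * c) / (((n : ℝ)) + 1) ^ p ≤ 1 / (((n : ℝ)) + 1) ^ 2 :=
    succ_pow_div_pow_le hp n
  calc gs j ^ (2 * p) * R j ^ c
      ≤ (m ^ p / (((n : ℝ)) + 1) ^ p) * (A ^ c * (((n : ℝ)) + 1) ^ (r * c)) := hprod
    _ = (m ^ p * A ^ c) * ((((n : ℝ)) + 1) ^ (r * c) / (((n : ℝ)) + 1) ^ p) := by ring
    _ ≤ (m ^ p * A ^ c) * (1 / (((n : ℝ)) + 1) ^ 2) :=
        mul_le_mul_of_nonneg_left hratio (mul_nonneg (pow_nonneg hm0 p) (pow_nonneg hA0 c))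
    _ = weightProfile (m ^ p * A ^ c) n := by rw [weightProfile, mul_one_div]

/-- **THE SUM OF THE WEIGHTS OVER THE BIRTH SCALES IS BOUNDED UNIFORMLY IN `K`** (the input "given
Σ_j g_j^{κ₀+2}R_j² < ∞" of T4-REF-O3 V5 (iv), in the crude-threshold form; plugs into
`T4TubeBudget.sum_weights_le_tsum` / `tubeBudget_uniform`): under the hypotheses of
`weight_le_profile_of_discrete031`, `Σ_{j ≤ K} gs_j^{2p} R_j^c ≤ Σ' n, weightProfile Cw n`, the right side independent
of `K`. [folklore] -/
theorem sum_weights_le_of_discrete031 {b β' g D : ℝ} {K r p c : ℕ} {gs R : ℕ → ℝ}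
    (h : Step.Discrete031 b β' K g gs) (hb : 0 < b) (hβ' : 0 ≤ β') (hg : 0 < g) (hD : 0 ≤ D)
    (hgs0 : ∀ j ≤ K, 0 < gs j) (hgs1 : ∀ j ≤ K, gs j ≤ 1) (hR0 : ∀ j ≤ K, 0 ≤ R j)
    (hR : ∀ j ≤ K, R j ≤ D * (Real.log ((gs j) ^ 2)⁻¹) ^ r) (hp : r * c + 2 ≤ p) :
    ∑ j ∈ range (K + 1), gs j ^ (2 * p) * R j ^ c
      ≤ ∑' n, weightProfile (((min (1 / g ^ 2) b)⁻¹) ^ p * (D * (1 / g ^ 2 + β') ^ r) ^ c) n := by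
  have hC : 0 ≤ ((min (1 / g ^ 2) b)⁻¹) ^ p * (D * (1 / g ^ 2 + β') ^ r) ^ c := by
    have : 0 < min (1 / g ^ 2) b := lt_min (by positivity) hb
    exact mul_nonneg (pow_nonneg (inv_nonneg.mpr this.le) p)
      (pow_nonneg (mul_nonneg hD (pow_nonneg (by positivity) r)) c)
  exact T4TubeBudget.sum_weights_le_tsum (w := fun j => gs j ^ (2 * p) * R j ^ c) (summable_weightProfile _)
    (weightProfile_nonneg hC)
    (fun j hj => weight_le_profile_of_discrete031 h hb hβ' hg hD hgs0 hgs1 hR0 hR hp hj)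

/-- **THE K-UNIFORM TUBE BUDGET KEYED TO (0.31)** (row text (b1) of O3b.B with the weights made explicit; plugs
`weight_le_profile_of_discrete031` into `T4TubeBudget.tubeBudget_uniform`): for a `K`-indexed family of coupling
sequences `gs K ·` each obeying `Step.Discrete031 b β' K g (gs K)` with the SAME `b > 0`, `β' ≥ 0`, `g > 0`, couplings in
`]0, 1]`, radii `0 ≤ R K j ≤ D(log (gs K j)⁻²)^r`, the crude threshold `r·c + 2 ≤ p`, and sizes of the rate shape
`s K j k ≤ A Λ^{k−j} τ^{K−j}` (`A, Λ, τ ≥ 0`, `τ ≤ 1`, `Λτ ≤ 1`), the SAME constant `A · Σ' n, weightProfile Cw n` is a tube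
budget for the weights `(gs K j)^{2p} (R K j)^c` at EVERY final scale `K`.  Whether Bałaban's sizes have the rate shape is
NOT asserted (NE1′). [folklore] -/
theorem tubeBudget_uniform_of_discrete031 {b β' g D A Λ τ : ℝ} {r p c : ℕ} {gs R : ℕ → ℕ → ℝ}
    {s : ℕ → ℕ → ℕ → ℝ} (h : ∀ K, Step.Discrete031 b β' K g (gs K)) (hb : 0 < b) (hβ' : 0 ≤ β') (hg : 0 < g)
    (hD : 0 ≤ D) (hgs0 : ∀ K, ∀ j ≤ K, 0 < gs K j) (hgs1 : ∀ K, ∀ j ≤ K, gs K j ≤ 1)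
    (hR0 : ∀ K, ∀ j ≤ K, 0 ≤ R K j) (hR : ∀ K, ∀ j ≤ K, R K j ≤ D * (Real.log ((gs K j) ^ 2)⁻¹) ^ r)
    (hp : r * c + 2 ≤ p) (hA : 0 ≤ A) (hΛ : 0 ≤ Λ) (hτ0 : 0 ≤ τ) (hτ1 : τ ≤ 1) (hΛτ : Λ * τ ≤ 1)
    (hs : ∀ K, ∀ k ≤ K, ∀ j ≤ k, s K j k ≤ A * Λ ^ (k - j) * τ ^ (K - j)) :
    ∀ K, T4TubeBudget.TubeBudget K (fun j => gs K j ^ (2 * p) * R K j ^ c) (s K)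
      (A * ∑' n, weightProfile (((min (1 / g ^ 2) b)⁻¹) ^ p * (D * (1 / g ^ 2 + β') ^ r) ^ c) n) := by
  have hC : 0 ≤ ((min (1 / g ^ 2) b)⁻¹) ^ p * (D * (1 / g ^ 2 + β') ^ r) ^ c := by
    have : 0 < min (1 / g ^ 2) b := lt_min (by positivity) hb
    exact mul_nonneg (pow_nonneg (inv_nonneg.mpr this.le) p)
      (pow_nonneg (mul_nonneg hD (pow_nonneg (by positivity) r)) c)
  exact T4TubeBudget.tubeBudget_uniform (w := fun K j => gs K j ^ (2 * p) * R K j ^ c)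
    (summable_weightProfile _) (weightProfile_nonneg hC)
    (fun K j hj => mul_nonneg (pow_nonneg (hgs0 K j hj).le _) (pow_nonneg (hR0 K j hj) _))
    (fun K j hj => weight_le_profile_of_discrete031 (h K) hb hβ' hg hD (hgs0 K) (hgs1 K) (hR0 K) (hR K) hp hj)
    hA hΛ hτ0 hτ1 hΛτ hs

/-! ## §4b (v1.1) The sharp threshold: `p ≥ 2` suffices for every polylogarithmic radius exponent -/

/-- THE SQUARE-ROOT WEIGHT PROFILE `Cw / ((n+1)·√(n+1))` (= `Cw·(n+1)^{−3/2}`) of the number `n = K − j` of remaining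
scales. [folklore] -/
noncomputable def sqrtProfile (Cw : ℝ) (n : ℕ) : ℝ :=
  Cw / ((((n : ℝ)) + 1) * Real.sqrt (((n : ℝ)) + 1))

/-- The square-root profile is nonnegative for `Cw ≥ 0`. [folklore] -/
theorem sqrtProfile_nonneg {Cw : ℝ} (hC : 0 ≤ Cw) (n : ℕ) : 0 ≤ sqrtProfile Cw n :=
  div_nonneg hC (mul_nonneg (by positivity) (Real.sqrt_nonneg _))

/-- `(n+1)^{3/2} = (n+1)·√(n+1)`, so the square-root profile is summable (a `p`-series with `p = 3/2`). [folklore] -/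
theorem summable_sqrtProfile (Cw : ℝ) : Summable (sqrtProfile Cw) := by
  have h32 : Summable (fun n : ℕ => 1 / (n : ℝ) ^ (3 / 2 : ℝ)) :=
    Real.summable_one_div_nat_rpow.mpr (by norm_num)
  have h : Summable (fun n : ℕ => 1 / (((n : ℝ)) + 1) ^ (3 / 2 : ℝ)) := by
    have h' := (summable_nat_add_iff 1).mpr h32
    simpa [Nat.cast_add, Nat.cast_one] using h'
  have hfun : sqrtProfile Cw = fun n : ℕ => Cw * (1 / (((n : ℝ)) + 1) ^ (3 / 2 : ℝ)) := by
    funext n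
    have hx : (0 : ℝ) ≤ (n : ℝ) + 1 := by positivity
    have h32' : (((n : ℝ)) + 1) ^ (3 / 2 : ℝ) = (((n : ℝ)) + 1) * Real.sqrt (((n : ℝ)) + 1) := by
      rw [show (3 / 2 : ℝ) = 1 + 1 / 2 by norm_num, Real.rpow_add' hx (by norm_num), Real.rpow_one,
        ← Real.sqrt_eq_rpow (((n : ℝ)) + 1)]
    rw [sqrtProfile, mul_one_div, h32']
  rw [hfun]
  exact h.mul_left Cw

/-- **A POLYLOGARITHM OF THE INVERSE COUPLING COSTS AT MOST ONE POWER OF THE COUPLING**: for `0 < x ≤ 1` and every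
`m`, `x · (log x⁻²)^m ≤ 2^m · m!` (from `uᵐ/m! ≤ eᵘ` at `u = −log x`). [folklore] -/
theorem mul_pow_log_inv_sq_le {x : ℝ} (hx0 : 0 < x) (hx1 : x ≤ 1) (m : ℕ) :
    x * (Real.log ((x ^ 2)⁻¹)) ^ m ≤ 2 ^ m * (m.factorial : ℝ) := by
  set u : ℝ := -Real.log x with hu
  have hu0 : 0 ≤ u := by
    rw [hu, neg_nonneg]
    exact Real.log_nonpos hx0.le hx1
  have hlog : Real.log ((x ^ 2)⁻¹) = 2 * u := by
    rw [Real.log_inv, Real.log_pow]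
    push_cast
    ring
  have hexp : Real.exp u = x⁻¹ := by
    rw [hu, Real.exp_neg, Real.exp_log hx0]
  have hfac : (0 : ℝ) < m.factorial := by positivity
  have hpow : u ^ m ≤ (m.factorial : ℝ) * Real.exp u := by
    have := Real.pow_div_factorial_le_exp u hu0 m
    rwa [div_le_iff₀ hfac, mul_comm] at this
  calc x * (Real.log ((x ^ 2)⁻¹)) ^ m = x * (2 ^ m * u ^ m) := by rw [hlog, mul_pow]
    _ ≤ x * (2 ^ m * ((m.factorial : ℝ) * Real.exp u)) :=
        mul_le_mul_of_nonneg_left (mul_le_mul_of_nonneg_left hpow (pow_nonneg (by norm_num) m)) hx0.le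
    _ = 2 ^ m * (m.factorial : ℝ) * (x * Real.exp u) := by ring
    _ = 2 ^ m * (m.factorial : ℝ) := by rw [hexp, mul_inv_cancel₀ hx0.ne', mul_one]

/-- **THE SHARP THRESHOLD — THE WEIGHTS ARE DOMINATED BY THE K-INDEPENDENT SQUARE-ROOT PROFILE AS SOON AS `p ≥ 2`**
(i.e. `κ₀ ≥ 2` for weights `g_j^{κ₀+2}R_j^c`), for EVERY polylogarithmic radius exponent `r` and EVERY power `c`: under the
LOWER half of `Step.Discrete031 b β' K g gs` (`b > 0`, `g > 0`; the upper half and `β'` are NOT used), couplings in `]0, 1]`,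
radii `0 ≤ R j ≤ D(log gs_j⁻²)^r` (`D ≥ 0`): `gs_j^{2p} · R_j^c ≤ sqrtProfile Cw (K − j)` with
`Cw = (min(1/g², b))^{−(p−1)} · √((min(1/g², b))⁻¹) · (D^c · 2^{rc} · (rc)!)`, independent of `K` and `j`.  Mechanism: one
power of `gs_j` absorbs the whole polylogarithm (`mul_pow_log_inv_sq_le`), the remaining `gs_j^{2p−1} ≤ (m/(n+1))^{p−1}·√(m/(n+1))`
with `n = K − j`.  Supersedes the crude threshold `r·c + 2 ≤ p` of `weight_le_profile_of_discrete031` (kept). [folklore] -/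
theorem weight_le_sqrtProfile_of_discrete031 {b β' g D : ℝ} {K r p c : ℕ} {gs R : ℕ → ℝ}
    (h : Step.Discrete031 b β' K g gs) (hb : 0 < b) (hg : 0 < g) (hD : 0 ≤ D)
    (hgs0 : ∀ j ≤ K, 0 < gs j) (hgs1 : ∀ j ≤ K, gs j ≤ 1) (hR0 : ∀ j ≤ K, 0 ≤ R j)
    (hR : ∀ j ≤ K, R j ≤ D * (Real.log ((gs j) ^ 2)⁻¹) ^ r) (hp : 2 ≤ p) {j : ℕ} (hj : j ≤ K) :
    gs j ^ (2 * p) * R j ^ c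
      ≤ sqrtProfile (((min (1 / g ^ 2) b)⁻¹) ^ (p - 1) * Real.sqrt ((min (1 / g ^ 2) b)⁻¹)
          * (D ^ c * 2 ^ (r * c) * ((r * c).factorial : ℝ))) (K - j) := by
  set n : ℕ := K - j with hn
  set m : ℝ := (min (1 / g ^ 2) b)⁻¹ with hm
  set E : ℝ := D ^ c * 2 ^ (r * c) * ((r * c).factorial : ℝ) with hE
  have hmin : 0 < min (1 / g ^ 2) b := lt_min (by positivity) hb
  have hm0 : 0 ≤ m := inv_nonneg.mpr hmin.le
  have hx0 : (0 : ℝ) < (n : ℝ) + 1 := by positivity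
  have hx1 : (1 : ℝ) ≤ (n : ℝ) + 1 := by
    have : (0 : ℝ) ≤ n := Nat.cast_nonneg n
    linarith
  have hgj : 0 < gs j := hgs0 j hj
  -- (1) gs_j² ≤ m / (n+1)
  have hsq : gs j ^ 2 ≤ m / (((n : ℝ)) + 1) := by
    have := pow_coupling_le_of_discrete031 h hg hb 1 hj hgj
    simpa [hm, hn] using this
  -- (2) gs_j ≤ √m / √(n+1)
  have hg1 : gs j ≤ Real.sqrt m / Real.sqrt (((n : ℝ)) + 1) := by
    calc gs j = Real.sqrt (gs j ^ 2) := (Real.sqrt_sq hgj.le).symm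
      _ ≤ Real.sqrt (m / (((n : ℝ)) + 1)) := Real.sqrt_le_sqrt hsq
      _ = Real.sqrt m / Real.sqrt (((n : ℝ)) + 1) := Real.sqrt_div hm0 _
  -- (3) (gs_j²)^(p−1) ≤ m^(p−1) / (n+1)
  have hpm1 : 1 ≤ p - 1 := by omega
  have hsqp : (gs j ^ 2) ^ (p - 1) ≤ m ^ (p - 1) / (((n : ℝ)) + 1) := by
    calc (gs j ^ 2) ^ (p - 1) ≤ (m / (((n : ℝ)) + 1)) ^ (p - 1) := pow_le_pow_left₀ (sq_nonneg _) hsq _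
      _ = m ^ (p - 1) / (((n : ℝ)) + 1) ^ (p - 1) := div_pow _ _ _
      _ ≤ m ^ (p - 1) / (((n : ℝ)) + 1) := by
          apply div_le_div_of_nonneg_left (pow_nonneg hm0 _) hx0
          calc (((n : ℝ)) + 1) = ((((n : ℝ)) + 1)) ^ 1 := (pow_one _).symm
            _ ≤ ((((n : ℝ)) + 1)) ^ (p - 1) := pow_le_pow_right₀ hx1 hpm1
  -- (4) one power of the coupling absorbs the polylogarithm: gs_j · R_j^c ≤ E
  have hRc : R j ^ c ≤ D ^ c * (Real.log ((gs j) ^ 2)⁻¹) ^ (r * c) := by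
    calc R j ^ c ≤ (D * (Real.log ((gs j) ^ 2)⁻¹) ^ r) ^ c := pow_le_pow_left₀ (hR0 j hj) (hR j hj) c
      _ = D ^ c * (Real.log ((gs j) ^ 2)⁻¹) ^ (r * c) := by rw [mul_pow, ← pow_mul]
  have hgR : gs j * R j ^ c ≤ E := by
    calc gs j * R j ^ c ≤ gs j * (D ^ c * (Real.log ((gs j) ^ 2)⁻¹) ^ (r * c)) :=
          mul_le_mul_of_nonneg_left hRc hgj.le
      _ = D ^ c * (gs j * (Real.log ((gs j) ^ 2)⁻¹) ^ (r * c)) := by ring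
      _ ≤ D ^ c * (2 ^ (r * c) * ((r * c).factorial : ℝ)) :=
          mul_le_mul_of_nonneg_left (mul_pow_log_inv_sq_le hgj (hgs1 j hj) (r * c)) (pow_nonneg hD c)
      _ = E := by rw [hE]; ring
  have hE0 : 0 ≤ E := mul_nonneg (mul_nonneg (pow_nonneg hD c) (pow_nonneg (by norm_num) _)) (Nat.cast_nonneg _)
  -- assemble: gs^(2p)·R^c = (gs²)^(p−1) · gs · (gs · R^c)
  have hsplit : gs j ^ (2 * p) * R j ^ c = (gs j ^ 2) ^ (p - 1) * gs j * (gs j * R j ^ c) := by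
    have h2p : 2 * p = 2 * (p - 1) + 1 + 1 := by omega
    rw [h2p, pow_succ, pow_succ, pow_mul]
    ring
  rw [hsplit]
  have hA0 : 0 ≤ m ^ (p - 1) / (((n : ℝ)) + 1) := div_nonneg (pow_nonneg hm0 _) hx0.le
  have hB0 : 0 ≤ Real.sqrt m / Real.sqrt (((n : ℝ)) + 1) := div_nonneg (Real.sqrt_nonneg _) (Real.sqrt_nonneg _)
  calc (gs j ^ 2) ^ (p - 1) * gs j * (gs j * R j ^ c)
      ≤ (m ^ (p - 1) / (((n : ℝ)) + 1)) * (Real.sqrt m / Real.sqrt (((n : ℝ)) + 1)) * E :=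
        mul_le_mul (mul_le_mul hsqp hg1 hgj.le hA0) hgR (mul_nonneg hgj.le (pow_nonneg (hR0 j hj) c))
          (mul_nonneg hA0 hB0)
    _ = sqrtProfile (m ^ (p - 1) * Real.sqrt m * E) n := by
        rw [sqrtProfile, div_mul_div_comm, div_mul_eq_mul_div]

/-- **THE SUM OF THE WEIGHTS IS BOUNDED UNIFORMLY IN `K`, SHARP THRESHOLD** (`p ≥ 2`, any `r`, `c`; plugs into
`T4TubeBudget.sum_weights_le_tsum`): `Σ_{j ≤ K} gs_j^{2p} R_j^c ≤ Σ' n, sqrtProfile Cw n`. [folklore] -/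
theorem sum_weights_le_of_discrete031_sharp {b β' g D : ℝ} {K r p c : ℕ} {gs R : ℕ → ℝ}
    (h : Step.Discrete031 b β' K g gs) (hb : 0 < b) (hg : 0 < g) (hD : 0 ≤ D)
    (hgs0 : ∀ j ≤ K, 0 < gs j) (hgs1 : ∀ j ≤ K, gs j ≤ 1) (hR0 : ∀ j ≤ K, 0 ≤ R j)
    (hR : ∀ j ≤ K, R j ≤ D * (Real.log ((gs j) ^ 2)⁻¹) ^ r) (hp : 2 ≤ p) :
    ∑ j ∈ range (K + 1), gs j ^ (2 * p) * R j ^ c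
      ≤ ∑' n, sqrtProfile (((min (1 / g ^ 2) b)⁻¹) ^ (p - 1) * Real.sqrt ((min (1 / g ^ 2) b)⁻¹)
          * (D ^ c * 2 ^ (r * c) * ((r * c).factorial : ℝ))) n := by
  have hC : 0 ≤ ((min (1 / g ^ 2) b)⁻¹) ^ (p - 1) * Real.sqrt ((min (1 / g ^ 2) b)⁻¹)
      * (D ^ c * 2 ^ (r * c) * ((r * c).factorial : ℝ)) := by
    have : 0 < min (1 / g ^ 2) b := lt_min (by positivity) hb
    exact mul_nonneg (mul_nonneg (pow_nonneg (inv_nonneg.mpr this.le) _) (Real.sqrt_nonneg _))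
      (mul_nonneg (mul_nonneg (pow_nonneg hD c) (pow_nonneg (by norm_num) _)) (Nat.cast_nonneg _))
  exact T4TubeBudget.sum_weights_le_tsum (w := fun j => gs j ^ (2 * p) * R j ^ c) (summable_sqrtProfile _)
    (sqrtProfile_nonneg hC)
    (fun j hj => weight_le_sqrtProfile_of_discrete031 h hb hg hD hgs0 hgs1 hR0 hR hp hj)

/-- **THE K-UNIFORM TUBE BUDGET KEYED TO (0.31), SHARP THRESHOLD** (`p ≥ 2`, any `r`, `c`; as
`tubeBudget_uniform_of_discrete031` with the square-root profile; `β'` and the upper half of (0.31) unused). [folklore] -/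
theorem tubeBudget_uniform_of_discrete031_sharp {b β' g D A Λ τ : ℝ} {r p c : ℕ} {gs R : ℕ → ℕ → ℝ}
    {s : ℕ → ℕ → ℕ → ℝ} (h : ∀ K, Step.Discrete031 b β' K g (gs K)) (hb : 0 < b) (hg : 0 < g)
    (hD : 0 ≤ D) (hgs0 : ∀ K, ∀ j ≤ K, 0 < gs K j) (hgs1 : ∀ K, ∀ j ≤ K, gs K j ≤ 1)
    (hR0 : ∀ K, ∀ j ≤ K, 0 ≤ R K j) (hR : ∀ K, ∀ j ≤ K, R K j ≤ D * (Real.log ((gs K j) ^ 2)⁻¹) ^ r)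
    (hp : 2 ≤ p) (hA : 0 ≤ A) (hΛ : 0 ≤ Λ) (hτ0 : 0 ≤ τ) (hτ1 : τ ≤ 1) (hΛτ : Λ * τ ≤ 1)
    (hs : ∀ K, ∀ k ≤ K, ∀ j ≤ k, s K j k ≤ A * Λ ^ (k - j) * τ ^ (K - j)) :
    ∀ K, T4TubeBudget.TubeBudget K (fun j => gs K j ^ (2 * p) * R K j ^ c) (s K)
      (A * ∑' n, sqrtProfile (((min (1 / g ^ 2) b)⁻¹) ^ (p - 1) * Real.sqrt ((min (1 / g ^ 2) b)⁻¹)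
          * (D ^ c * 2 ^ (r * c) * ((r * c).factorial : ℝ))) n) := by
  have hC : 0 ≤ ((min (1 / g ^ 2) b)⁻¹) ^ (p - 1) * Real.sqrt ((min (1 / g ^ 2) b)⁻¹)
      * (D ^ c * 2 ^ (r * c) * ((r * c).factorial : ℝ)) := by
    have : 0 < min (1 / g ^ 2) b := lt_min (by positivity) hb
    exact mul_nonneg (mul_nonneg (pow_nonneg (inv_nonneg.mpr this.le) _) (Real.sqrt_nonneg _))
      (mul_nonneg (mul_nonneg (pow_nonneg hD c) (pow_nonneg (by norm_num) _)) (Nat.cast_nonneg _))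
  exact T4TubeBudget.tubeBudget_uniform (w := fun K j => gs K j ^ (2 * p) * R K j ^ c)
    (summable_sqrtProfile _) (sqrtProfile_nonneg hC)
    (fun K j hj => mul_nonneg (pow_nonneg (hgs0 K j hj).le _) (pow_nonneg (hR0 K j hj) _))
    (fun K j hj => weight_le_sqrtProfile_of_discrete031 (h K) hb hg hD (hgs0 K) (hgs1 K) (hR0 K) (hR K) hp hj)
    hA hΛ hτ0 hτ1 hΛτ hs

/-! ## §5 Non-vacuity -/

/-- The empty booking satisfies every per-scale predicate with constant `0`, has the birth bound for any array, and
its (vacuous) gated step holds for every gate; so the gated induction is consistent. [folklore] -/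
theorem vacuum_gated (K : ℕ) (σ : ℕ → ℕ → ℝ) (w : ℕ → ℝ) (Gate : ℕ → Prop) :
    BirthBound (vacuum K) σ ∧ GatedStep (vacuum K) σ Gate ∧
      (∀ k, SizeBoundAt (vacuum K) σ k) ∧ (∀ k, CubeBudgetAt (vacuum K) w 0 k) := by
  refine ⟨fun b => (nomatch b), fun _ _ _ _ b => (nomatch b), fun _ b => (nomatch b), fun k q _ => ?_⟩
  have h : ∀ j, (vacuum K).load q j = 0 := fun j => by simp [load, feltOfScale, vacuum]
  simp [h]

/-- A NON-EMPTY instance where the gate genuinely carries the induction: one birth at scale `0`, one cube per scale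
`k ≤ K` feeling it, sizes `size b k = 1` for all `k`; with `σ ≡ 1`, unit weights and `c = 1` the budget gate holds at
every scale and the step gated by it returns the size bound — while NO information beyond the gate is used. [folklore] -/
def oneBirth (K : ℕ) : T4TermFormat.Booking where
  K := K
  Dom := Unit
  domScale := fun _ => 0
  treeLen := fun _ => 0
  treeLen_nonneg := fun _ => le_rfl
  balSize := fun _ => 0
  Birth := Unit
  births := {()}
  mem_births := fun b => by simp
  birthScale := fun _ => 0
  birth_le := fun _ => Nat.zero_le K
  loc := fun _ => ()
  loc_scale := fun _ => rfl
  Cube := Fin (K + 1)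
  cubes := Finset.univ
  mem_cubes := fun q => Finset.mem_univ q
  cubeScale := fun q => q.val
  cube_le := fun q => Nat.lt_succ_iff.mp q.isLt
  feltAt := fun _ => {()}
  felt_birth_le := fun _ _ _ => Nat.zero_le _
  size := fun _ _ => 1
  size_nonneg := fun _ _ => zero_le_one
  pair := fun _ _ _ => 0

/-- The loads of `oneBirth K`: `1` at birth scale `0`, `0` otherwise. [folklore] -/
theorem oneBirth_load (K : ℕ) (q : (oneBirth K).Cube) (j : ℕ) :
    (oneBirth K).load q j = if j = 0 then 1 else 0 := by
  by_cases hj : j = 0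
  · subst hj; simp [load, feltOfScale, oneBirth]
  · simp [load, feltOfScale, oneBirth, hj, Ne.symm hj]

/-- In `oneBirth K` the budget gate (unit weights, `c = 1`) is met from the sizes `σ ≡ 1` — in fact outright.
[folklore] -/
theorem oneBirth_gateOfSizes (K : ℕ) :
    GateOfSizes (oneBirth K) (fun _ _ => 1) (CubeBudgetAt (oneBirth K) (fun _ => 1) 1) := by
  intro k _ _ q _
  simp [oneBirth_load, sum_ite_eq', mem_range]

/-- In `oneBirth K`: the birth bound, the budget gate met from sizes, a step gated by the budget, hence `SizeBound 1`
and `CubeBudget 1 1` by the gated induction (array level). [folklore] -/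
theorem oneBirth_gated (K : ℕ) :
    (oneBirth K).SizeBound (fun _ _ => 1) ∧ (oneBirth K).CubeBudget (fun _ => 1) 1 := by
  have h0 : BirthBound (oneBirth K) (fun _ _ => 1) := fun _ => le_rfl
  have hstep : GatedStep (oneBirth K) (fun _ _ => 1) (CubeBudgetAt (oneBirth K) (fun _ => 1) 1) :=
    fun _ _ _ _ _ _ => le_rfl
  exact ⟨sizeBound_of_gatedStep h0 (oneBirth_gateOfSizes K) hstep,
    cubeBudget_iff.mpr fun k hk => gate_of_gatedStep h0 (oneBirth_gateOfSizes K) hstep k hk⟩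

/-- A later-scale carrier on `oneBirth K` (trivial fluctuation and tower types, constant value `1`). [folklore] -/
def oneBirthCarrier (K : ℕ) : (oneBirth K).CarrierAt where
  Fluc := fun _ => Unit
  Tower := fun _ => Unit
  towerDom := fun _ => Set.univ
  val := fun _ _ _ _ => 1
  μ₀ := 1
  μ₀_pos := one_pos
  FlucAt := fun _ _ => Unit
  valAt := fun _ _ _ _ _ => 1
  flucAtBirth := fun _ => Equiv.refl Unit
  valAt_birth := fun _ _ _ _ => rfl

/-- … and at function level: birth-level norm bound, the budget gate met from norms (through the sizes chosen `≤ σ`),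
a gated one-step operator bound, hence `NormBound 1` and the budget at every scale (function level). [folklore] -/
theorem oneBirthCarrier_gated (K : ℕ) :
    (oneBirthCarrier K).NormBound (fun _ _ => 1) ∧ ∀ k, k ≤ K → CubeBudgetAt (oneBirth K) (fun _ => 1) 1 k := by
  have h0 : BirthNormBound (oneBirthCarrier K) (fun _ _ => 1) := fun _ _ _ _ _ _ => by simp [oneBirthCarrier]
  have hgate : GateOfNorms (oneBirthCarrier K) (fun _ _ => 1) (CubeBudgetAt (oneBirth K) (fun _ => 1) 1) :=
    gateOfNorms_of_gateOfSizes (fun _ _ _ _ _ => le_rfl) (oneBirth_gateOfSizes K)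
  have hstep : GatedOneStepBound (oneBirthCarrier K) (fun _ _ => 1) (CubeBudgetAt (oneBirth K) (fun _ => 1) 1) :=
    fun _ _ _ _ _ _ _ _ _ _ _ => by simp [oneBirthCarrier]
  exact ⟨normBound_of_gatedStep h0 hgate hstep, gate_of_gatedOneStepBound h0 hgate hstep⟩

end Literature.MathematicalPhysics.QuantumFieldTheory.Balaban1983to89.T4GatedBooking
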